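import Mathlib.Tactic
import HarnessLib

/-!
# Kozma–Nitzan's Question 8 — the C-threshold form of UB(δ): THEOREM Ψ-MC₀ and the accounting kernels (gen 48)

Support file (`--supports stmt-CriticalPhenomena-4575`, closed crux; independent mathematics on Kozma–Nitzan's Question 8,
arXiv:2401.12397 §5.5 p. 36), prover `prim-ineq-gen-6` (gen 48).  No definitions, no named facts, no sorries; standard axioms.
Memo `run/shared/lean/prim/prim-ineq-gen-6/PROOF-MC0-G48.md`.

Vocabulary of a path-end block (memos OPEN-L0-G25, PROOF-PSIA-G47): moments `ε, π, m`, `Φ = ε+π−m`, `D = ε−m`, `σ = π+m`;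
cumulative marks `a_j, γ_j`; suffix channels `u″, v″, m″` of `T_{j+1}`.  The *moment-threshold form* of C-shallowness is
`MC_j : γ_j·(Φ+m) ≥ σ`, i.e. `γ_j·D − (1−γ_j)·σ ≥ 0` (`kMC_threshold_form`); it implies the gen-47 hypothesis `HC_j`
(`γ_j a_j S_{j+1} v″ ≥ (1−γ_j)π`) by the near-moment cut `E1 ≥ 0` (`kMC_imp_HC`), and at depth 0 the two coincide
(`kHC0_eq_MC0`, root-step coordinates).  THEOREM Ψ-MC₀ (this generation; exact 6-variable Bernstein certificate, kit evidence on
the item): `Φ·ψ₀ = λ·[γ₀D − (1−γ₀)σ] − γ₀·σ₀` with `λ = a₀γ₀s₁u″(m + s₁(γ₀u″ + a₀v″)) ≥ 0` and `σ₀ ≥ 0`, whence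
`ψ₀ > 0 ⟹ γ₀(Φ+m) > σ` (`kPsiMC0_of_cert`, `kLIN0_of_cert`).  The accounting kernels record why UB(δ) at a δ-positive class of
the 'pure linear world' (no positive x̂ below the class) is THEOREM UB(Ψ̂) of gen 46 (`kM_split`, `kLam_eq_Psihat_of_Mzero`,
`kUBd_linear_world`), the linearity of `E_j[ψ]` in the capped moment vector (`kPsi_class_linear`), and the lifting identity from the
truncated-average inequality `B_j ≥ 0` to the hat inequality LIN_j (`kXi_lift`).
[cite: KozmaNitzan2024, Question 8 (§5.5 p. 36)]
-/

namespace Summit.CriticalPhenomena.PercolationContinuityZ3.Theorems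

namespace PocketCert

open Finset

/-- **MC-slack, threshold form.**  `γ·D − (1−γ)·σ = γ·(ε+π) − (π+m)` with `D = ε − m`, `σ = π + m`: the moment form of
C-shallowness says the cumulative C-mark `γ_j` is at least the global ratio `(π+m)/(ε+π) = σ/(Φ+m)`.
[cite: KozmaNitzan2024, Question 8 (§5.5 p. 36)] -/
theorem kMC_threshold_form (γ ε π m : ℝ) :
    γ * (ε - m) - (1 - γ) * (π + m) = γ * (ε + π) - (π + m) := by
  ring

/-- **Depth 0: HC₀ and MC₀ coincide.**  In root-step coordinates (`b₀ = (a,g)`, first edge `s`, suffix channels `u,v,w`,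
`M₁ = (u+v+w) − s(u+v)`, `Π = M₁ + s u`, `π = gΠ`, `D = a(sv + (1−g)M₁)`, `σ = gΠ + a g M₁`):
`g a s v − (1−g)π = gD − (1−g)σ`.
[cite: KozmaNitzan2024, Question 8 (§5.5 p. 36)] -/
theorem kHC0_eq_MC0 (a g s u v w : ℝ) :
    let M1 := (u + v + w) - s * (u + v)
    let Pi := M1 + s * u
    g * a * s * v - (1 - g) * (g * Pi) = g * (a * (s * v + (1 - g) * M1)) - (1 - g) * (g * Pi + a * g * M1) := by
  intro M1 Pi
  ring

/-- **MC_j implies HC_j.**  With the near/far splits `D = DN + S a ((1−γ) w + v)`, `m = MN + S a γ w` (`S = S_{j+1}`,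
`(u,v,w)` the channels of `T_{j+1}`) and the near-moment cut `E1 = (1−γ)MN − γ DN ≥ 0` (gen 47, kernel `kPsiA_nearC`):
`γ a S v − (1−γ)π = [γD − (1−γ)(π+m)] + E1`, so `MC_j ⟹ HC_j`.
[cite: KozmaNitzan2024, Question 8 (§5.5 p. 36)] -/
theorem kMC_imp_HC (γ a S v w π DN MN D m : ℝ)
    (hD : D = DN + S * a * ((1 - γ) * w + v)) (hm : m = MN + S * a * γ * w)
    (hE1 : 0 ≤ (1 - γ) * MN - γ * DN) (hMC : 0 ≤ γ * D - (1 - γ) * (π + m)) :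
    (1 - γ) * π ≤ γ * a * S * v := by
  have hid : γ * a * S * v - (1 - γ) * π = (γ * D - (1 - γ) * (π + m)) + ((1 - γ) * MN - γ * DN) := by
    rw [hD, hm]; ring
  linarith

/-- **THEOREM Ψ-MC₀ from the certificate.**  If `Φ·ψ₀ = λ·MCs − g·σ₀` with `Φ > 0`, `λ ≥ 0`, `g ≥ 0`, `σ₀ ≥ 0`
(the gen-48 identity; `σ₀ ≥ 0` by its 2800 nonnegative Bernstein coefficients), then `ψ₀ > 0 ⟹ MCs > 0`.
[cite: KozmaNitzan2024, Question 8 (§5.5 p. 36)] -/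
theorem kPsiMC0_of_cert (Φ ψ0 lam MCs g σ0 : ℝ) (hid : Φ * ψ0 = lam * MCs - g * σ0)
    (hΦ : 0 < Φ) (hlam : 0 ≤ lam) (hg : 0 ≤ g) (hσ : 0 ≤ σ0) (hψ : 0 < ψ0) : 0 < MCs := by
  have h1 : 0 < Φ * ψ0 := mul_pos hΦ hψ
  have h2 : 0 < lam * MCs := by nlinarith [mul_nonneg hg hσ]
  rcases lt_or_ge 0 MCs with h | h
  · exact h
  · exfalso; nlinarith [mul_nonneg hlam (neg_nonneg.mpr h)]

/-- **LIN₀.**  The same identity gives the linear bound `Φ·ψ₀ ≤ λ·MCs` (the depth-0 member of the conjectured family LIN_j).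
[cite: KozmaNitzan2024, Question 8 (§5.5 p. 36)] -/
theorem kLIN0_of_cert (Φ ψ0 lam MCs g σ0 : ℝ) (hid : Φ * ψ0 = lam * MCs - g * σ0)
    (hg : 0 ≤ g) (hσ : 0 ≤ σ0) : Φ * ψ0 ≤ lam * MCs := by
  nlinarith [mul_nonneg hg hσ]

/-- **The λ of THEOREM Ψ-MC₀ is nonnegative**: `λ = a g s u (m + s(g u + a v))` with all factors in `[0,1]`/nonnegative.
[cite: KozmaNitzan2024, Question 8 (§5.5 p. 36)] -/
theorem kLam0_nonneg (a g s u v m : ℝ) (ha : 0 ≤ a) (hg : 0 ≤ g) (hs : 0 ≤ s) (hu : 0 ≤ u) (hv : 0 ≤ v) (hm : 0 ≤ m) :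
    0 ≤ a * g * s * u * (m + s * (g * u + a * v)) := by
  have h1 : 0 ≤ m + s * (g * u + a * v) := by positivity
  positivity

/-- **Split of δ into Ψ̂ and the down-set x-mass.**  With `Ψ̂_j = ψ_j + Σ_k r_k Ψ̂_k`, `U_j = Ψ̂_j + x̂_j` and
`Λ_j = ψ_j + Σ_k r_k δ_k`, `δ_k = Ψ̂_k + M_k`:  `δ_j = max(U_j, Λ_j) = Ψ̂_j + max(x̂_j, Σ_k r_k M_k)`, i.e. `M_j = max(x̂_j, Σ_k r_k M_k)`.
[cite: KozmaNitzan2024, Question 8 (§5.5 p. 36)] -/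
theorem kM_split {ι : Type*} (s : Finset ι) (psi xhat : ℝ) (r Ph Mk : ι → ℝ) :
    max ((psi + ∑ k ∈ s, r k * Ph k) + xhat) (psi + ∑ k ∈ s, r k * (Ph k + Mk k))
      = (psi + ∑ k ∈ s, r k * Ph k) + max xhat (∑ k ∈ s, r k * Mk k) := by
  have h1 : ∑ k ∈ s, r k * (Ph k + Mk k) = ∑ k ∈ s, r k * Ph k + ∑ k ∈ s, r k * Mk k := by
    rw [← Finset.sum_add_distrib]
    refine Finset.sum_congr rfl ?_
    intro k _; ring
  rw [h1, ← add_assoc, max_add_add_left]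

/-- **Pure linear world.**  If no child carries down-set x-mass (`M_k = 0` for all `k < j`) then `Λ_j = ψ_j + Σ_k r_k(Ψ̂_k + M_k) = Ψ̂_j`.
[cite: KozmaNitzan2024, Question 8 (§5.5 p. 36)] -/
theorem kLam_eq_Psihat_of_Mzero {ι : Type*} (s : Finset ι) (psi : ℝ) (r Ph Mk : ι → ℝ) (hM : ∀ k ∈ s, Mk k = 0) :
    psi + ∑ k ∈ s, r k * (Ph k + Mk k) = psi + ∑ k ∈ s, r k * Ph k := by
  congr 1
  refine Finset.sum_congr rfl ?_
  intro k hk; rw [hM k hk]; ring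

/-- **UB(δ) in the pure linear world** is THEOREM UB ∧ THEOREM UB(Ψ̂): if `U_j ≤ c·μ̂^_j` (gen 28), `Ψ̂_j ≤ c·μ̂^_j` (gen 46)
and `Λ_j = Ψ̂_j` (no down-set x-mass below `j`), then `δ_j = max(U_j, Λ_j) ≤ c·μ̂^_j` — whatever the sign of the per-class slack `φ_j`.
[cite: KozmaNitzan2024, Question 8 (§5.5 p. 36)] -/
theorem kUBd_linear_world (U Lam Psihat cmuh : ℝ) (hU : U ≤ cmuh) (hP : Psihat ≤ cmuh) (hL : Lam = Psihat) :
    max U Lam ≤ cmuh := by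
  rw [hL]; exact max_le hU hP

/-- **ψ is linear in the class data.**  `ψ_k = c·p·M(a,γ) − aγ[(K₄+Φσ)p − Φσ] = (c−K₄)·(aγp) + Φσ·(aγ(1−p)) + c·(γ(1−a)p + a(1−γ)p)`,
so the truncated average `E_j[ψ]` is `(c−K₄)M + ΦσH + c(U+V)` in the capped moment vector `(M,H,U,V)` of gen 46.
[cite: KozmaNitzan2024, Question 8 (§5.5 p. 36)] -/
theorem kPsi_class_linear (c K4 Ps a γ p : ℝ) :
    c * p * (a + γ - a * γ) - a * γ * ((K4 + Ps) * p - Ps)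
      = (c - K4) * (a * γ * p) + Ps * (a * γ * (1 - p)) + c * (γ * (1 - a) * p + a * (1 - γ) * p) := by
  ring

/-- **Lifting identity (B_j ⟹ LIN_j).**  With the ub-step recursion `S_j Ψ̂_j = E_j[ψ] + s_{j+1} Σ_{j′<j} c_{j′} Ψ̂_{j′}`
(`c_{j′} ≥ 0`, `S_{j′} > 0`), the hat slack `Ξ_j := λ_j MCs_j − Φ S_j Ψ̂_j` equals
`B_j + s_{j+1} Σ_{j′} (c_{j′}/S_{j′}) Ξ_{j′}` where `B_j := λ_j MCs_j − Φ E_j[ψ] − s_{j+1} Σ_{j′} (c_{j′}/S_{j′}) λ_{j′} MCs_{j′}`;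
hence `B ≥ 0` at every class gives `Ξ ≥ 0` at every class by induction.
[cite: KozmaNitzan2024, Question 8 (§5.5 p. 36)] -/
theorem kXi_lift {ι : Type*} (s : Finset ι) (lam MCs Φ E s1 : ℝ) (c S Ph lamk MCsk : ι → ℝ) (hS : ∀ k ∈ s, S k ≠ 0) :
    lam * MCs - Φ * (E + s1 * ∑ k ∈ s, c k * Ph k)
      = (lam * MCs - Φ * E - s1 * ∑ k ∈ s, (c k / S k) * (lamk k * MCsk k))
        + s1 * ∑ k ∈ s, (c k / S k) * (lamk k * MCsk k - Φ * S k * Ph k) := by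
  have h1 : ∀ k ∈ s, (c k / S k) * (lamk k * MCsk k - Φ * S k * Ph k)
      = (c k / S k) * (lamk k * MCsk k) - Φ * (c k * Ph k) := by
    intro k hk
    have hk' := hS k hk
    have h2 : (c k / S k) * (Φ * S k * Ph k) = Φ * (c k * Ph k) := by
      calc (c k / S k) * (Φ * S k * Ph k) = (Φ * (c k * Ph k)) * (S k / S k) := by ring
        _ = Φ * (c k * Ph k) := by rw [div_self hk', mul_one]
    rw [mul_sub, h2]
  rw [Finset.sum_congr rfl h1, Finset.sum_sub_distrib, ← Finset.mul_sum]
  ring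

/-- **Induction step of the lifting.**  If `B_j ≥ 0`, `s_{j+1} ≥ 0`, the coefficients `c_{j′}/S_{j′} ≥ 0` and the earlier
slacks `Ξ_{j′} ≥ 0`, then `Ξ_j = B_j + s_{j+1} Σ (c/S)·Ξ ≥ 0`.
[cite: KozmaNitzan2024, Question 8 (§5.5 p. 36)] -/
theorem kXi_step {ι : Type*} (s : Finset ι) (B s1 : ℝ) (q Xi : ι → ℝ) (hB : 0 ≤ B) (hs1 : 0 ≤ s1)
    (hq : ∀ k ∈ s, 0 ≤ q k) (hXi : ∀ k ∈ s, 0 ≤ Xi k) : 0 ≤ B + s1 * ∑ k ∈ s, q k * Xi k := by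
  have h1 : 0 ≤ ∑ k ∈ s, q k * Xi k := Finset.sum_nonneg (fun k hk => mul_nonneg (hq k hk) (hXi k hk))
  positivity


/-! ### Depth 1 (gen 48, second part): THEOREMS LIN₁, LIN-SEG(1)₁, E-LIN₁ by native Bernstein nonnegativity

For every path-end block (`n ≥ 3`, any suffix `T₂`): `Φ·s₁·Ψ̂₁ ≤ λ₁·MCs₁`, `Φ·s₁·(ψ₁ + r₀₁U₀) ≤ λ₁·MCs₁` and `Φ·E₁[ψ] ≤ λ₁·MCs₁`
(`λ₁ = a₁γ₁S₂u″(m + S₂(γ₁u″ + a₁v″)) ≥ 0`, `MCs₁ = γ₁D − (1−γ₁)σ`): after clearing `p₀` and `C₀` each difference is an integer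
polynomial in the nine variables `(A₀,A₁,C₀,C₁,s₁,s₂;u″,v″,m″)` all of whose product-Bernstein coefficients are `≥ 0`
(226 433 / 230 360 / 107 675 nonzero coefficients, minimum 1; kit evidence on the item).  Since `Λ₁ = ψ₁ + r₀₁·max(U₀,ψ₀)` is the
maximum of the two certified functionals (`kLam1_two_forms`), `Λ₁ > 0 ⟹ MC₁` (`kMC_of_two_LIN`) — the lag half at depth 1 in
threshold form — and `Ψ̂₁ > 0 ⟹ MC₁` (`kMC_of_LIN`). -/

/-- **An implication from a linear bound.**  If `Φ·S·L ≤ λ·MCs` with `Φ, S > 0`, `λ ≥ 0`, then `L > 0 ⟹ MCs > 0`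
(used with `L = Ψ̂_j`: THEOREM LIN_j ⟹ (PT)_j `Ψ̂_j > 0 ⟹ MC_j`).
[cite: KozmaNitzan2024, Question 8 (§5.5 p. 36)] -/
theorem kMC_of_LIN (Φ S L lam MCs : ℝ) (hLIN : Φ * S * L ≤ lam * MCs) (hΦ : 0 < Φ) (hS : 0 < S) (hlam : 0 ≤ lam)
    (hL : 0 < L) : 0 < MCs := by
  have h1 : 0 < Φ * S * L := by positivity
  have h2 : 0 < lam * MCs := lt_of_lt_of_le h1 hLIN
  rcases lt_or_ge 0 MCs with h | h
  · exact h
  · exfalso; nlinarith [mul_nonneg hlam (neg_nonneg.mpr h)]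

/-- **Λ₁ as a maximum of two linear functionals.**  With `r ≥ 0`: `ψ₁ + r·max(U₀, ψ₀) = max(ψ₁ + r·U₀, ψ₁ + r·ψ₀)`.
[cite: KozmaNitzan2024, Question 8 (§5.5 p. 36)] -/
theorem kLam1_two_forms (psi1 r U0 psi0 : ℝ) (hr : 0 ≤ r) :
    psi1 + r * max U0 psi0 = max (psi1 + r * U0) (psi1 + r * psi0) := by
  rcases le_total U0 psi0 with h | h
  · rw [max_eq_right h, max_eq_right (by nlinarith [mul_le_mul_of_nonneg_left h hr])]
  · rw [max_eq_left h, max_eq_left (by nlinarith [mul_le_mul_of_nonneg_left h hr])]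

/-- **Lag half at depth 1 in threshold form.**  If both functionals `L₀ = ψ₁ + r·U₀` and `L₁ = ψ₁ + r·ψ₀` satisfy the certified
linear bounds `Φ·S·L_i ≤ λ·MCs` (`Φ, S > 0`, `λ ≥ 0`), then `Λ₁ = max(L₀, L₁) > 0 ⟹ MCs > 0`, i.e. `Λ₁ > 0 ⟹ γ₁(Φ+m) > σ ⟹ HC₁ ⟹ φ₁ ≥ 0`.
[cite: KozmaNitzan2024, Question 8 (§5.5 p. 36)] -/
theorem kMC_of_two_LIN (Φ S L0 L1 lam MCs : ℝ) (h0 : Φ * S * L0 ≤ lam * MCs) (h1 : Φ * S * L1 ≤ lam * MCs)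
    (hΦ : 0 < Φ) (hS : 0 < S) (hlam : 0 ≤ lam) (hΛ : 0 < max L0 L1) : 0 < MCs := by
  rcases le_total L0 L1 with h | h
  · rw [max_eq_right h] at hΛ; exact kMC_of_LIN Φ S L1 lam MCs h1 hΦ hS hlam hΛ
  · rw [max_eq_left h] at hΛ; exact kMC_of_LIN Φ S L0 lam MCs h0 hΦ hS hlam hΛ


/-- **No down-set x-mass propagates.**  One step of the induction `x̂_i ≤ 0 ∀ i ≤ k ⟹ M_k = 0`: if `x̂_k ≤ 0` and every child already
has `M_i = 0`, then `M_k = max(x̂_k, Σ_i r_i M_i) = 0` (so a lag class without positive x̂ in its history is in the 'pure linear world'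
of `kUBd_linear_world`).
[cite: KozmaNitzan2024, Question 8 (§5.5 p. 36)] -/
theorem kM_zero_step {ι : Type*} (s : Finset ι) (xhat : ℝ) (r Mk : ι → ℝ) (hx : xhat ≤ 0) (hM : ∀ k ∈ s, Mk k = 0) :
    max xhat (∑ k ∈ s, r k * Mk k) = 0 := by
  have h0 : ∑ k ∈ s, r k * Mk k = 0 := Finset.sum_eq_zero (fun k hk => by rw [hM k hk, mul_zero])
  rw [h0]; exact max_eq_right hx

/-- **Root-step face (depth 1, gen 48).**  The normalised depth-1 slack decomposes along the first edge weight as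
`P₁ = s₁³·L + (1 − s₁)·Q` with `L = p₀C₁·P₀(T′)` the lifted depth-0 slack of the contraction and `Q` a polynomial all of whose
product-Bernstein coefficients are positive (kit evidence); hence `P₁ ≥ 0` from `L ≥ 0`, `Q ≥ 0`, `0 ≤ s₁ ≤ 1` — the shape of the
conjectured all-depth induction.
[cite: KozmaNitzan2024, Question 8 (§5.5 p. 36)] -/
theorem kFace_step (P L Q s : ℝ) (hP : P = s ^ 3 * L + (1 - s) * Q) (hL : 0 ≤ L) (hQ : 0 ≤ Q) (hs0 : 0 ≤ s) (hs1 : s ≤ 1) :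
    0 ≤ P := by
  rw [hP]
  have h1 : 0 ≤ s ^ 3 * L := mul_nonneg (pow_nonneg hs0 3) hL
  have h2 : 0 ≤ (1 - s) * Q := mul_nonneg (by linarith) hQ
  linarith


/-! ### Depth 2 (gen 48, third part): Λ₂ as a maximum of four certified linear functionals

At depth 2, `δ₀ = max(U₀, ψ₀)`, `δ₁ = max(U₁, ψ₁ + r₀₁δ₀)` and `Λ₂ = ψ₂ + r₀₂δ₀ + r₁₂δ₁` is the maximum of the four linear
functionals `Ψ̂₂` (SEG0), `Ψ̂₂ + R₀₂x₀` (SEG1), `Ψ̂₂ + X^{<2}₂` (SEG2) and `Ψ̂₂ + r₁₂x̂₁` (HIT1) (`kLam2_four_forms`, written in the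
`ψ/U` coordinates); the kernels below reduce `Λ₂ > 0 ⟹ MC₂` to the four linear bounds `Φ·S₂·L ≤ λ₂·MCs₂` (`kMC_of_four_LIN`); at depth 1 the
analogous bounds are certified (kit evidence on the item), at depth 2 the native Bernstein checks of the exact 12-variable polynomials
are kit jobs recorded in the memo (E-LIN₂ already certified nonnegative). -/

/-- **Affine image of a max (r ≥ 0).** `c + r·max(a,b) = max(c + r a, c + r b)`.
[cite: KozmaNitzan2024, Question 8 (§5.5 p. 36)] -/
theorem kmax_affine (c r a b : ℝ) (hr : 0 ≤ r) : c + r * max a b = max (c + r * a) (c + r * b) := by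
  rcases le_total a b with h | h
  · rw [max_eq_right h, max_eq_right (by nlinarith [mul_le_mul_of_nonneg_left h hr])]
  · rw [max_eq_left h, max_eq_left (by nlinarith [mul_le_mul_of_nonneg_left h hr])]

/-- **Λ₂ as a maximum of four linear functionals** (`r₀₁, r₀₂, r₁₂ ≥ 0`):
`ψ₂ + r₀₂·max(U₀,ψ₀) + r₁₂·max(U₁, ψ₁ + r₀₁·max(U₀,ψ₀))` equals the max of `ψ₂ + r₁₂U₁ + r₀₂U₀`, `ψ₂ + r₁₂U₁ + r₀₂ψ₀`,
`ψ₂ + r₁₂ψ₁ + (r₀₂ + r₁₂r₀₁)U₀`, `ψ₂ + r₁₂ψ₁ + (r₀₂ + r₁₂r₀₁)ψ₀`.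
[cite: KozmaNitzan2024, Question 8 (§5.5 p. 36)] -/
theorem kLam2_four_forms (psi2 psi1 psi0 U1 U0 r01 r02 r12 : ℝ) (h01 : 0 ≤ r01) (h02 : 0 ≤ r02) (h12 : 0 ≤ r12) :
    psi2 + r02 * max U0 psi0 + r12 * max U1 (psi1 + r01 * max U0 psi0)
      = max (max (psi2 + r12 * U1 + r02 * U0) (psi2 + r12 * U1 + r02 * psi0))
            (max (psi2 + r12 * psi1 + (r02 + r12 * r01) * U0) (psi2 + r12 * psi1 + (r02 + r12 * r01) * psi0)) := by
  have h3 : 0 ≤ r02 + r12 * r01 := by positivity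
  rcases le_total U0 psi0 with h | h <;> rcases le_total U1 (psi1 + r01 * max U0 psi0) with k | k
  · rw [max_eq_right h] at k ⊢; rw [max_eq_right k]
    have e1 : psi2 + r12 * U1 + r02 * U0 ≤ psi2 + r12 * U1 + r02 * psi0 := by nlinarith [mul_le_mul_of_nonneg_left h h02]
    have e2 : psi2 + r12 * psi1 + (r02 + r12 * r01) * U0 ≤ psi2 + r12 * psi1 + (r02 + r12 * r01) * psi0 := by nlinarith [mul_le_mul_of_nonneg_left h h3]
    rw [max_eq_right e1, max_eq_right e2]
    have e3 : psi2 + r12 * U1 + r02 * psi0 ≤ psi2 + r12 * psi1 + (r02 + r12 * r01) * psi0 := by nlinarith [mul_le_mul_of_nonneg_left k h12]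
    rw [max_eq_right e3]; ring
  · rw [max_eq_right h] at k ⊢; rw [max_eq_left k]
    have e1 : psi2 + r12 * U1 + r02 * U0 ≤ psi2 + r12 * U1 + r02 * psi0 := by nlinarith [mul_le_mul_of_nonneg_left h h02]
    have e2 : psi2 + r12 * psi1 + (r02 + r12 * r01) * U0 ≤ psi2 + r12 * psi1 + (r02 + r12 * r01) * psi0 := by nlinarith [mul_le_mul_of_nonneg_left h h3]
    rw [max_eq_right e1, max_eq_right e2]
    have e3 : psi2 + r12 * psi1 + (r02 + r12 * r01) * psi0 ≤ psi2 + r12 * U1 + r02 * psi0 := by nlinarith [mul_le_mul_of_nonneg_left k h12]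
    rw [max_eq_left e3]; ring
  · rw [max_eq_left h] at k ⊢; rw [max_eq_right k]
    have e1 : psi2 + r12 * U1 + r02 * psi0 ≤ psi2 + r12 * U1 + r02 * U0 := by nlinarith [mul_le_mul_of_nonneg_left h h02]
    have e2 : psi2 + r12 * psi1 + (r02 + r12 * r01) * psi0 ≤ psi2 + r12 * psi1 + (r02 + r12 * r01) * U0 := by nlinarith [mul_le_mul_of_nonneg_left h h3]
    rw [max_eq_left e1, max_eq_left e2]
    have e3 : psi2 + r12 * U1 + r02 * U0 ≤ psi2 + r12 * psi1 + (r02 + r12 * r01) * U0 := by nlinarith [mul_le_mul_of_nonneg_left k h12]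
    rw [max_eq_right e3]; ring
  · rw [max_eq_left h] at k ⊢; rw [max_eq_left k]
    have e1 : psi2 + r12 * U1 + r02 * psi0 ≤ psi2 + r12 * U1 + r02 * U0 := by nlinarith [mul_le_mul_of_nonneg_left h h02]
    have e2 : psi2 + r12 * psi1 + (r02 + r12 * r01) * psi0 ≤ psi2 + r12 * psi1 + (r02 + r12 * r01) * U0 := by nlinarith [mul_le_mul_of_nonneg_left h h3]
    rw [max_eq_left e1, max_eq_left e2]
    have e3 : psi2 + r12 * psi1 + (r02 + r12 * r01) * U0 ≤ psi2 + r12 * U1 + r02 * U0 := by nlinarith [mul_le_mul_of_nonneg_left k h12]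
    rw [max_eq_left e3]; ring

/-- **MC from four certified linear bounds.**  If four functionals each obey `Φ·S·L_i ≤ λ·MCs` (`Φ, S > 0`, `λ ≥ 0`) and their
maximum is positive, then `MCs > 0` — with `kLam2_four_forms`: `Λ₂ > 0 ⟹ γ₂(Φ+m) > σ ⟹ HC₂ ⟹ φ₂ ≥ 0`.
[cite: KozmaNitzan2024, Question 8 (§5.5 p. 36)] -/
theorem kMC_of_four_LIN (Φ S L1 L2 L3 L4 lam MCs : ℝ) (h1 : Φ * S * L1 ≤ lam * MCs) (h2 : Φ * S * L2 ≤ lam * MCs)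
    (h3 : Φ * S * L3 ≤ lam * MCs) (h4 : Φ * S * L4 ≤ lam * MCs) (hΦ : 0 < Φ) (hS : 0 < S) (hlam : 0 ≤ lam)
    (hΛ : 0 < max (max L1 L2) (max L3 L4)) : 0 < MCs := by
  rcases lt_max_iff.mp hΛ with h | h
  · rcases lt_max_iff.mp h with h' | h'
    · exact kMC_of_LIN Φ S L1 lam MCs h1 hΦ hS hlam h'
    · exact kMC_of_LIN Φ S L2 lam MCs h2 hΦ hS hlam h'
  · rcases lt_max_iff.mp h with h' | h'
    · exact kMC_of_LIN Φ S L3 lam MCs h3 hΦ hS hlam h'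
    · exact kMC_of_LIN Φ S L4 lam MCs h4 hΦ hS hlam h'

/-- **MC propagation along the prefix.**  With `γ_j = C_j·γ_{j−1}`:  `MCs_j = C_j·MCs_{j−1} − (1−C_j)·σ`
(`MCs_k = γ_k·D − (1−γ_k)·σ`); in particular a C-perfect vertex (`C_j = 1`) carries the threshold inequality from class `j−1`
to class `j` unchanged — which is how the exact residue instance of PROOF-MC0-G48 §1(e) (pattern U,L,L with `C₁ = C₂ = 1`) is
covered by the depth-1 theorem `Λ₁ > 0 ⟹ MC₁`.
[cite: KozmaNitzan2024, Question 8 (§5.5 p. 36)] -/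
theorem kMC_propagate (Cj γprev D σ : ℝ) :
    (Cj * γprev) * D - (1 - Cj * γprev) * σ = Cj * (γprev * D - (1 - γprev) * σ) - (1 - Cj) * σ := by
  ring

end PocketCert

end Summit.CriticalPhenomena.PercolationContinuityZ3.Theorems
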